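import Mathlib
import HarnessLib

/-!
# Exact algebraic specialisation of one transcendental (support lemma for `SemivaluationShadows`)

Support file for the crux `stmt-ResolutionOfSingularities-16757`
(`Summit.ResolutionOfSingularities.ResolutionOfSingularities.Theses.AbhyankarShadows.SemivaluationShadows`,
route `AbhyankarShadows`, line `birth`, open cores `stub_exactArcs` / `stub_higherRankShadows`).

The intended engine of both open cores specialises a transcendental `y` of `K` over a subfield to an
ALGEBRAIC element `ρ'` without changing the values of finitely many prescribed polynomials
(standing Disproof `Cruxes/SemivaluationShadows/Disproof.lean`, R3/R3': MacLane–Vaquié truncations /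
model-completeness of ACVF). This file proves the elementary valuation-theoretic heart of that step,
with no key polynomials and no model theory:

* `exists_valuation_sub_lt_of_saturated` — if a subfield `A` of a valued field `(M, w)` carries ALL
  values (`∀ d ≠ 0, ∃ a ∈ A, w a = w d`) and ALL residues (`∀ u, w u = 1 → ∃ c ∈ A, w (u - c) < 1`),
  then an element `y ∉ A` is a PSEUDO-LIMIT from `A` that is never attained: every approximant
  `ρ ∈ A` is strictly beaten by some `ρ' ∈ A` (`w (y - ρ') < w (y - ρ)`).
* `exists_forall_valuation_sub_lt` — hence `y` can be approximated from `A` strictly better than any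
  finite set of elements of `A`.
* `valuation_eval_eq_of_forall_lt` — if `ρ'` is closer to `y` than every root of a split polynomial
  `f`, then `w (f.eval ρ') = w (f.eval y)` (ultrametric inequality root by root).
* `exists_exact_specialisation_of` / `exists_exact_specialisation` — the package: for finitely many polynomials split with roots in `A`,
  some `ρ' ∈ A` has `w (f.eval ρ') = w (f.eval y)` for all of them.

Application (not formalised here): `A = K₀^alg` inside an algebraic closure of `K = K₀(y)` with an
extension of `ν`, when `K₀ ⊆ K` carries the full rational rank of `ν` and all residue fields are the
algebraically closed ground field `k` — then both saturation hypotheses hold, and `y ↦ ρ'` is a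
`K₀`-algebra map `K₀[y] → K₀^alg` exact on any prescribed finite `F ⊆ K₀[y]`.

Sources: classical (Ostrowski/Kaplansky pseudo-convergence; MacLane 1936). [folklore]
-/

set_option linter.dupNamespace false -- mandated namespace of this single-conjunct summit

namespace Summit.ResolutionOfSingularities.ResolutionOfSingularities.Theorems

open Polynomial

variable {M Γ₀ : Type*} [Field M] [LinearOrderedCommGroupWithZero Γ₀] (w : Valuation M Γ₀)

/-- **A pseudo-limit over a value- and residue-saturated subfield is never attained.** If the
subfield `A ⊆ M` carries every value of `w` and every residue of `w`, then for `y ∉ A` every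
approximant `ρ ∈ A` of `y` is strictly improved by some `ρ' ∈ A`: write `d = y - ρ`, pick `a ∈ A`
with `w a = w d` and `c ∈ A` congruent to the unit `d / a`; then `ρ' = ρ + a c`. [folklore] -/
theorem exists_valuation_sub_lt_of_saturated (A : Subfield M)
    (hval : ∀ d : M, d ≠ 0 → ∃ a ∈ A, w a = w d)
    (hres : ∀ u : M, w u = 1 → ∃ c ∈ A, w (u - c) < 1)
    {y : M} (hy : y ∉ A) {ρ : M} (hρ : ρ ∈ A) :
    ∃ ρ' ∈ A, w (y - ρ') < w (y - ρ) := by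
  set d := y - ρ with hd
  have hd0 : d ≠ 0 := fun h => hy (by rwa [hd, sub_eq_zero.mp h] at *)
  obtain ⟨a, haA, ha⟩ := hval d hd0
  have ha0 : a ≠ 0 := by
    rintro rfl
    rw [map_zero] at ha
    exact hd0 ((map_eq_zero w).mp ha.symm)
  have hwa0 : w a ≠ 0 := (map_ne_zero w).mpr ha0
  have hu : w (d / a) = 1 := by rw [map_div₀, ← ha, div_self hwa0]
  obtain ⟨c, hcA, hc⟩ := hres (d / a) hu
  refine ⟨ρ + a * c, A.add_mem hρ (A.mul_mem haA hcA), ?_⟩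
  have hrew : y - (ρ + a * c) = a * (d / a - c) := by
    rw [mul_sub, mul_div_cancel₀ _ ha0, hd]; ring
  rw [hrew, map_mul, ha]
  calc w d * w (d / a - c) < w d * 1 := by
        exact mul_lt_mul_of_pos_left hc (zero_lt_iff.mpr ((map_ne_zero w).mpr hd0))
    _ = w d := mul_one _

/-- **Beating any finite set of approximants.** Under the same saturation hypotheses, `y ∉ A` is
strictly closer to some `ρ' ∈ A` than to each element of any finite set `T ⊆ A`. [folklore] -/
theorem exists_forall_valuation_sub_lt (A : Subfield M)
    (hval : ∀ d : M, d ≠ 0 → ∃ a ∈ A, w a = w d)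
    (hres : ∀ u : M, w u = 1 → ∃ c ∈ A, w (u - c) < 1)
    {y : M} (hy : y ∉ A) (T : Finset M) (hT : ∀ τ ∈ T, τ ∈ A) :
    ∃ ρ' ∈ A, ∀ τ ∈ T, w (y - ρ') < w (y - τ) := by
  rcases T.eq_empty_or_nonempty with rfl | hne
  · exact ⟨0, A.zero_mem, fun τ hτ => by simp at hτ⟩
  · obtain ⟨τ₀, hτ₀, hmin⟩ := T.exists_min_image (fun τ => w (y - τ)) hne
    obtain ⟨ρ', hρ', hlt⟩ := exists_valuation_sub_lt_of_saturated w A hval hres hy (hT τ₀ hτ₀)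
    exact ⟨ρ', hρ', fun τ hτ => hlt.trans_le (hmin τ hτ)⟩

/-- **Root-by-root exactness.** If `ρ'` is strictly closer to `y` than every root of a split
polynomial `f`, then `f` takes the same value at `ρ'` and at `y`. [folklore] -/
theorem valuation_eval_eq_of_forall_lt {f : M[X]} (hf : f.Splits) {y ρ' : M}
    (h : ∀ τ ∈ f.roots, w (y - ρ') < w (y - τ)) : w (f.eval ρ') = w (f.eval y) := by
  rw [hf.eval_eq_prod_roots ρ', hf.eval_eq_prod_roots y, map_mul, map_mul, map_multiset_prod,
    map_multiset_prod, Multiset.map_map, Multiset.map_map]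
  congr 1
  refine congrArg Multiset.prod (Multiset.map_congr rfl fun τ hτ => ?_)
  show w (ρ' - τ) = w (y - τ)
  have hrew : ρ' - τ = (y - τ) - (y - ρ') := by ring
  rw [hrew]
  exact Valuation.map_sub_eq_of_lt_left w (h τ hτ)

/-- **Exact algebraic specialisation on a finite set.** If the subfield `A` of the valued field
`(M, w)` carries all values and all residues of `w`, and `y ∉ A`, then for every finite set `S` of
polynomials that split with all roots in `A` there is `ρ' ∈ A` with `w (f.eval ρ') = w (f.eval y)`
for every `f ∈ S`: the specialisation `y ↦ ρ'` is exact on `S`. (With `A = K₀^alg` inside an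
algebraic closure of `K₀(y)`, all residue fields equal to an algebraically closed ground field and
`K₀` carrying the rational rank, this is the first step of the intended engine for the open cores
of the crux.) [folklore] -/
theorem exists_exact_specialisation_of (A : Subfield M)
    (hval : ∀ d : M, d ≠ 0 → ∃ a ∈ A, w a = w d)
    (hres : ∀ u : M, w u = 1 → ∃ c ∈ A, w (u - c) < 1)
    {y : M} (hy : y ∉ A) (S : Finset M[X])
    (hS : ∀ f ∈ S, f.Splits ∧ ∀ τ ∈ f.roots, τ ∈ A) :
    ∃ ρ' ∈ A, ∀ f ∈ S, w (f.eval ρ') = w (f.eval y) := by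
  classical
  let T : Finset M := S.biUnion fun f => f.roots.toFinset
  have hT : ∀ τ ∈ T, τ ∈ A := by
    intro τ hτ
    obtain ⟨f, hf, hτf⟩ := Finset.mem_biUnion.mp hτ
    exact (hS f hf).2 τ (Multiset.mem_toFinset.mp hτf)
  obtain ⟨ρ', hρ', hlt⟩ := exists_forall_valuation_sub_lt w A hval hres hy T hT
  refine ⟨ρ', hρ', fun f hf => valuation_eval_eq_of_forall_lt w (hS f hf).1 fun τ hτ => ?_⟩
  exact hlt τ (Finset.mem_biUnion.mpr ⟨f, hf, Multiset.mem_toFinset.mpr hτ⟩)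

/-- **Exact algebraic specialisation on a finite set** (registered sub-goal form of
`exists_exact_specialisation_of`, fully quantified): a pseudo-limit `y ∉ A` over a value- and
residue-saturated subfield `A` of a valued field specialises to some `ρ' ∈ A` with the same values
on any finite set of polynomials split with roots in `A`. [folklore] -/
theorem exists_exact_specialisation : ∀ {M Γ₀ : Type*} [Field M] [LinearOrderedCommGroupWithZero Γ₀] (w : Valuation M Γ₀) (A : Subfield M), (∀ d : M, d ≠ 0 → ∃ a ∈ A, w a = w d) → (∀ u : M, w u = 1 → ∃ c ∈ A, w (u - c) < 1) → ∀ {y : M}, y ∉ A → ∀ (S : Finset (Polynomial M)), (∀ f ∈ S, f.Splits ∧ ∀ τ ∈ f.roots, τ ∈ A) → ∃ ρ' ∈ A, ∀ f ∈ S, w (f.eval ρ') = w (f.eval y) :=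
  fun w A hval hres _ hy S hS => exists_exact_specialisation_of w A hval hres hy S hS

/-! ## Saturation of the relative algebraic closure inside an algebraically closed valued field

In the application `M` is an algebraic closure of `K = K₀(y)` with an extension `w` of `ν`, and
`A` is the relative algebraic closure of (the image `K₀'` of) `K₀` in `M`. The two saturation
hypotheses of `exists_exact_specialisation` then follow from two hypotheses on `K₀'` alone:
every value of `M` is TORSION over the values of `K₀'` (`Γ(K)/Γ(K₀)` torsion, i.e. `K₀` carries the
rational rank, and `M/K` algebraic), and every unit of `M` is congruent to an element of `K₀'`
(all residue fields equal to the algebraically closed ground field `k ⊆ K₀`). -/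

/-- **All values are attained in the relative algebraic closure.** If `M` is algebraically closed
and every value `w z` (`z ≠ 0`) has a power `(w z)^N`, `N ≠ 0`, which is a value of the subfield
`K₀'`, then every value of `M` is the value of an element ALGEBRAIC over `K₀'` (an `N`-th root of
the witness). [folklore] -/
theorem exists_mem_algebraicClosure_valuation_eq [IsAlgClosed M] (K₀' : Subfield M)
    (htors : ∀ z : M, z ≠ 0 → ∃ N : ℕ, N ≠ 0 ∧ ∃ b ∈ K₀', w z ^ N = w b)
    (d : M) (hd : d ≠ 0) :
    ∃ a ∈ (algebraicClosure K₀' M).toSubfield, w a = w d := by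
  obtain ⟨N, hN, b, hbK, hb⟩ := htors d hd
  obtain ⟨a, ha⟩ := IsAlgClosed.exists_pow_nat_eq b (Nat.pos_of_ne_zero hN)
  refine ⟨a, ?_, ?_⟩
  · show a ∈ algebraicClosure K₀' M
    rw [mem_algebraicClosure_iff]
    refine ⟨X ^ N - C (⟨b, hbK⟩ : K₀'), X_pow_sub_C_ne_zero (Nat.pos_of_ne_zero hN) _, ?_⟩
    simp only [map_sub, map_pow, aeval_X, aeval_C, ha]
    exact sub_eq_zero.mpr rfl
  · have h : w a ^ N = w d ^ N := by rw [← map_pow, ha, hb]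
    exact (pow_left_inj₀ zero_le zero_le hN).mp h

/-- **All residues are attained in the relative algebraic closure** (trivially, from `K₀' ≤ A`).
[folklore] -/
theorem exists_mem_algebraicClosure_valuation_sub_lt (K₀' : Subfield M)
    (hresK : ∀ u : M, w u = 1 → ∃ c ∈ K₀', w (u - c) < 1) (u : M) (hu : w u = 1) :
    ∃ c ∈ (algebraicClosure K₀' M).toSubfield, w (u - c) < 1 := by
  obtain ⟨c, hcK, hc⟩ := hresK u hu
  exact ⟨c, (algebraicClosure K₀' M).algebraMap_mem (⟨c, hcK⟩ : K₀'), hc⟩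

/-- Over an algebraically closed `M`, the image of a non-zero `f ∈ K₀'[X]` splits and its roots
lie in the relative algebraic closure of `K₀'`. [folklore] -/
theorem splits_map_and_roots_mem_algebraicClosure [IsAlgClosed M] (K₀' : Subfield M)
    (f : K₀'[X]) (hf : f ≠ 0) :
    (f.map (algebraMap K₀' M)).Splits ∧
      ∀ τ ∈ (f.map (algebraMap K₀' M)).roots, τ ∈ (algebraicClosure K₀' M).toSubfield := by
  refine ⟨IsAlgClosed.splits _, fun τ hτ => ?_⟩
  show τ ∈ algebraicClosure K₀' M
  rw [mem_algebraicClosure_iff]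
  have hf' : f.map (algebraMap K₀' M) ≠ 0 := Polynomial.map_ne_zero hf
  refine ⟨f, hf, ?_⟩
  rw [aeval_def, ← eval_map]
  exact (mem_roots hf').mp hτ

/-- **Step A of the specialisation engine for one transcendental.** Let `M` be an algebraically
closed valued field and `K₀' ⊆ M` a subfield over whose values every value of `M` is torsion
and which represents every residue of `M`. Then every `y ∈ M` TRANSCENDENTAL over `K₀'`
specialises, for any finite set `S` of non-zero polynomials over `K₀'`, to an element `ρ'`
ALGEBRAIC over `K₀'` with `w (f(ρ')) = w (f(y))` for all `f ∈ S`: the `K₀'`-algebra map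
`K₀'[y] → K₀'(ρ')`, `y ↦ ρ'`, is exact on `S`. (Registered sub-goal of the open cores of the crux
`SemivaluationShadows`.) [folklore] -/
theorem exists_exact_specialisation_algebraicClosure : ∀ {M Γ₀ : Type*} [Field M] [IsAlgClosed M] [LinearOrderedCommGroupWithZero Γ₀] (w : Valuation M Γ₀) (K₀' : Subfield M), (∀ z : M, z ≠ 0 → ∃ N : ℕ, N ≠ 0 ∧ ∃ b ∈ K₀', w z ^ N = w b) → (∀ u : M, w u = 1 → ∃ c ∈ K₀', w (u - c) < 1) → ∀ {y : M}, ¬ IsAlgebraic K₀' y → ∀ (S : Finset (Polynomial K₀')), (∀ f ∈ S, f ≠ 0) → ∃ ρ' : M, IsAlgebraic K₀' ρ' ∧ ∀ f ∈ S, w (Polynomial.aeval ρ' f) = w (Polynomial.aeval y f) := by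
  intro M Γ₀ _ _ _ w K₀' htors hresK y hy S hS0
  classical
  let A : Subfield M := (algebraicClosure K₀' M).toSubfield
  have hyA : y ∉ A := fun h => hy (mem_algebraicClosure_iff.mp h)
  let S' : Finset M[X] := S.image (Polynomial.map (algebraMap K₀' M))
  have hS' : ∀ g ∈ S', g.Splits ∧ ∀ τ ∈ g.roots, τ ∈ A := by
    intro g hg
    obtain ⟨f, hf, rfl⟩ := Finset.mem_image.mp hg
    exact splits_map_and_roots_mem_algebraicClosure K₀' f (hS0 f hf)
  obtain ⟨ρ', hρ'A, hρ'⟩ := exists_exact_specialisation_of w A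
    (exists_mem_algebraicClosure_valuation_eq w K₀' htors)
    (exists_mem_algebraicClosure_valuation_sub_lt w K₀' hresK) hyA S' hS'
  refine ⟨ρ', mem_algebraicClosure_iff.mp hρ'A, fun f hf => ?_⟩
  have h := hρ' (f.map (algebraMap K₀' M)) (Finset.mem_image.mpr ⟨f, hf, rfl⟩)
  rwa [eval_map, eval_map, ← aeval_def, ← aeval_def] at h

/-! ## Minimal approximants: exactness below the degree and VALUE-GROUP CONTROL

The value-group control needed by the cores ("(**)" in `Cruxes/SemivaluationShadows/CORE.md`) comes
for free in one transcendental if the approximant is chosen of MINIMAL DEGREE in the exactness ball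
(a "minimal pair" in the sense of Alexandru–Popescu–Zaharescu / Khanduja): then EVERY polynomial of
degree smaller than the degree of the approximant keeps its value under `y ↦ ρ'` (all its roots have
smaller degree, hence lie outside the ball), so the value group of `K₀'(ρ') = K₀'[ρ']` — every
element of which is such a polynomial in `ρ'` — is generated by values of polynomials in `y`, i.e.
lies inside the value group of `K₀'(y)`: no extra ramification. -/

/-- **Minimal approximants are exact below their degree.** Let `M` be an algebraically closed valued
field, `K₀' ⊆ M` a subfield over whose values every value of `M` is torsion and which represents every
residue of `M`, and `y ∈ M` transcendental over `K₀'`. For every finite set `S` of non-zero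
polynomials over `K₀'` there is `ρ' ∈ M`, ALGEBRAIC over `K₀'`, such that `w (f(ρ')) = w (f(y))` for
all `f ∈ S` AND for every non-zero `g ∈ K₀'[X]` of degree `< deg_{K₀'} ρ'`. Construction: an element of
minimal degree among the algebraic elements of the ball beating all roots of `S`. (Registered
sub-goal of the open cores of the crux `SemivaluationShadows`: it is the value-group control (**) for
one transcendental.) [folklore] -/
theorem exists_minimal_exact_specialisation : ∀ {M Γ₀ : Type*} [Field M] [IsAlgClosed M] [LinearOrderedCommGroupWithZero Γ₀] (w : Valuation M Γ₀) (K₀' : Subfield M), (∀ z : M, z ≠ 0 → ∃ N : ℕ, N ≠ 0 ∧ ∃ b ∈ K₀', w z ^ N = w b) → (∀ u : M, w u = 1 → ∃ c ∈ K₀', w (u - c) < 1) → ∀ {y : M}, ¬ IsAlgebraic K₀' y → ∀ (S : Finset (Polynomial K₀')), (∀ f ∈ S, f ≠ 0) → ∃ ρ' : M, IsAlgebraic K₀' ρ' ∧ (∀ f ∈ S, w (Polynomial.aeval ρ' f) = w (Polynomial.aeval y f)) ∧ ∀ g : Polynomial K₀', g ≠ 0 → g.natDegree < (minpoly K₀'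 ρ').natDegree → w (Polynomial.aeval ρ' g) = w (Polynomial.aeval y g) := by
  intro M Γ₀ _ _ _ w K₀' htors hresK y hy S hS0
  classical
  let A : Subfield M := (algebraicClosure K₀' M).toSubfield
  have hyA : y ∉ A := fun h => hy (mem_algebraicClosure_iff.mp h)
  have hval := exists_mem_algebraicClosure_valuation_eq w K₀' htors
  have hres := exists_mem_algebraicClosure_valuation_sub_lt w K₀' hresK
  -- the roots of `S`, and a first approximant `ρ₀` beating them all
  let S' : Finset M[X] := S.image (Polynomial.map (algebraMap K₀' M))
  let T : Finset M := S'.biUnion fun g => g.roots.toFinset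
  have hT : ∀ τ ∈ T, τ ∈ A := by
    intro τ hτ
    obtain ⟨g, hg, hτg⟩ := Finset.mem_biUnion.mp hτ
    obtain ⟨f, hf, rfl⟩ := Finset.mem_image.mp hg
    exact (splits_map_and_roots_mem_algebraicClosure K₀' f (hS0 f hf)).2 τ
      (Multiset.mem_toFinset.mp hτg)
  obtain ⟨ρ₀, hρ₀A, hρ₀⟩ := exists_forall_valuation_sub_lt w A hval hres hyA T hT
  -- the ball `B = {b ∈ A | w (y - b) ≤ w (y - ρ₀)}` and an element of minimal degree in it
  have hP : ∃ n : ℕ, ∃ b : M, b ∈ A ∧ w (y - b) ≤ w (y - ρ₀) ∧ (minpoly K₀' b).natDegree = n :=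
    ⟨_, ρ₀, hρ₀A, le_rfl, rfl⟩
  obtain ⟨ρ', hρ'A, hρ'le, hρ'deg⟩ := Nat.find_spec hP
  have hmin : ∀ b : M, b ∈ A → w (y - b) ≤ w (y - ρ₀) →
      (minpoly K₀' ρ').natDegree ≤ (minpoly K₀' b).natDegree := by
    intro b hbA hb
    rw [hρ'deg]
    exact Nat.find_min' hP ⟨b, hbA, hb, rfl⟩
  have hρ'alg : IsAlgebraic K₀' ρ' := mem_algebraicClosure_iff.mp hρ'A
  refine ⟨ρ', hρ'alg, fun f hf => ?_, fun g hg0 hgdeg => ?_⟩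
  · -- exactness on `S`: `ρ'` lies in the ball beating all roots
    have h := valuation_eval_eq_of_forall_lt w
      (splits_map_and_roots_mem_algebraicClosure K₀' f (hS0 f hf)).1 (y := y) (ρ' := ρ')
      (fun τ hτ => hρ'le.trans_lt (hρ₀ τ (Finset.mem_biUnion.mpr
        ⟨f.map (algebraMap K₀' M), Finset.mem_image.mpr ⟨f, hf, rfl⟩, Multiset.mem_toFinset.mpr hτ⟩)))
    rwa [eval_map, eval_map, ← aeval_def, ← aeval_def] at h
  · -- exactness below the degree: roots of `g` have smaller degree, hence are outside the ball
    obtain ⟨hsplit, hroots⟩ := splits_map_and_roots_mem_algebraicClosure K₀' g hg0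
    have h := valuation_eval_eq_of_forall_lt w hsplit (y := y) (ρ' := ρ') (fun τ hτ => ?_)
    · rwa [eval_map, eval_map, ← aeval_def, ← aeval_def] at h
    · have hτA : τ ∈ A := hroots τ hτ
      have hτroot : Polynomial.aeval τ g = 0 := by
        rw [aeval_def, ← eval_map]
        exact (mem_roots (Polynomial.map_ne_zero hg0)).mp hτ |>.eq_zero
      have hτdeg : (minpoly K₀' τ).natDegree ≤ g.natDegree :=
        Polynomial.natDegree_le_natDegree (minpoly.degree_le_of_ne_zero K₀' τ hg0 hτroot)
      -- if `τ` were in the ball, minimality would give `deg ρ' ≤ deg τ ≤ deg g`, absurd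
      by_contra hle
      push Not at hle
      exact absurd ((hmin τ hτA (hle.trans hρ'le)).trans hτdeg) (not_le.mpr hgdeg)

end Summit.ResolutionOfSingularities.ResolutionOfSingularities.Theorems
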